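/-
COR-CM (cell pub-hodgecm2) — RSCONJ row F2c-cat (mukey-p6 RULINGS HOME∕INBOX l.15162): the CATEGORICAL half of the pieces transport —
generic base-change bookkeeping, no Shimura content.  Pen prover-pub-hodgecm2-d2bridge-prove-5-g2-0.  KERNEL: theorems only, explicit
binders, no instance, no notation, no named fact, no `sorry`.  HC_CM is NOT proved; HELD — WORLD = C FINAL; this file discharges no END binder.
-/
import Literature.AlgebraicGeometry.Motives.ConjugatePointsHomeomorph
import Summits.HodgeConjecture.CorCM.B01.Transposition.HComp.BaseChangeComp
import Mathlib.CategoryTheory.Adjunction.Limits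
import Mathlib.CategoryTheory.Limits.Preserves.Shapes.Products
import HarnessLib

/-!
# Base change along a ring isomorphism: equivalence, colimit cofans, and naturality of `toConjugate`

* `isEquivalence_baseChangeHom_ringEquiv`: for a ring isomorphism `σ : k ≃+* k'`, base change `Sch/k ⥤ Sch/k'`
  (`Motives.baseChangeHom σ = Over.pullback (Spec σ)`) is an equivalence of categories, with quasi-inverse the base change
  along `σ⁻¹` (Mathlib `Over.pullbackComp`, `Over.pullbackId`; the pattern of the tree's `AbelianVariety.baseChangeEquivOfInverse`);
* `nonempty_isColimit_cofan_baseChangeHom_ringEquiv`: hence it carries colimit cofans to colimit cofans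
  (Mathlib `isColimitCofanMkObjOfIsColimit`); `nonempty_isColimit_cofan_reindex`: re-indexing a colimit cofan along an
  equivalence of index types (Mathlib `Cofan.isColimitEquivOfEquiv`);
* `map_baseChangeHom_map_toConjugate`: the bijection `Y(ℂ) → Y^σ(ℂ)` (`AlgPoints.toConjugate`, Charles–Schnell (11.2.1)) is
  natural in the `ℂ`-scheme `Y`.

Used by `HComp/RecordSystemConjPieces` (the pieces of the conjugate record system: cofan of ball quotients transported along
`baseChangeHom conj`).  References: [GortzWedhorn2020] §(4.7) (base change); [CharlesSchnell2014Notes] §11.2.2 (11.2.1).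
-/

set_option autoImplicit false

noncomputable section

open CategoryTheory AlgebraicGeometry
open Literature.AlgebraicGeometry.Motives

universe u

namespace Summit.HodgeConjecture.CorCM.Model.RecordSystemConj

section Cofan

open Limits
open Literature.AlgebraicGeometry.Motives.AlgPoints (toConjugate)

/-! ### (a) base change along a ring isomorphism is an equivalence and carries colimit cofans to colimit cofans -/

/-- `Spec(σ⁻¹) ≫ Spec(σ) = 𝟙` for a ring isomorphism `σ` (functoriality of `Spec`). [folklore] -/
theorem specMap_symm_comp_specMap_of_ringEquiv {k k' : Type u} [CommRing k] [CommRing k'] (σ : k ≃+* k') :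
    Spec.map (CommRingCat.ofHom σ.symm.toRingHom) ≫ Spec.map (CommRingCat.ofHom σ.toRingHom) =
      𝟙 (Spec (CommRingCat.of k)) := by
  have h : σ.symm.toRingHom.comp σ.toRingHom = RingHom.id k := RingHom.ext fun z => σ.symm_apply_apply z
  rw [← Spec.map_comp, ← CommRingCat.ofHom_comp, h, CommRingCat.ofHom_id, Spec.map_id]

/-- **Base change of schemes along a ring ISOMORPHISM `σ : k ≃+* k'` is an equivalence of categories** `Sch/k ≌ Sch/k'`, with
quasi-inverse the base change along `σ⁻¹` (Mathlib `Over.pullbackComp`, `Over.pullbackId`; the pattern of the tree's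
`AbelianVariety.baseChangeEquivOfInverse`).  Used at `σ = conj : ℂ ≃+* ℂ`. [cite: GortzWedhorn2020, §(4.7)] -/
theorem isEquivalence_baseChangeHom_ringEquiv {k k' : Type u} [CommRing k] [CommRing k'] (σ : k ≃+* k') :
    (baseChangeHom σ.toRingHom).IsEquivalence := by
  have h2 := specMap_symm_comp_specMap_of_ringEquiv σ.symm
  rw [RingEquiv.symm_symm] at h2
  exact (CategoryTheory.Equivalence.mk (baseChangeHom σ.toRingHom) (baseChangeHom σ.symm.toRingHom)
      (Over.pullbackId.symm ≪≫ eqToIso (HComp.overPullback_congr (specMap_symm_comp_specMap_of_ringEquiv σ).symm) ≪≫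
        Over.pullbackComp _ _)
      ((Over.pullbackComp _ _).symm ≪≫ eqToIso (HComp.overPullback_congr h2) ≪≫ Over.pullbackId)).isEquivalence_functor

/-- **Base change along a ring isomorphism carries a colimit cofan to a colimit cofan** (an equivalence preserves colimits;
Mathlib `isColimitCofanMkObjOfIsColimit`). [cite: GortzWedhorn2020, §(4.7)] -/
theorem nonempty_isColimit_cofan_baseChangeHom_ringEquiv {k k' : Type u} [CommRing k] [CommRing k'] (σ : k ≃+* k')
    {Ξ : Type*} (X : Ξ → SchemeOver k) {V : SchemeOver k} (ι : ∀ q, X q ⟶ V) (h : IsColimit (Cofan.mk V ι)) :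
    Nonempty (IsColimit (Cofan.mk ((baseChangeHom σ.toRingHom).obj V)
      (fun q => (baseChangeHom σ.toRingHom).map (ι q)) :
        Cofan fun q => (baseChangeHom σ.toRingHom).obj (X q))) := by
  haveI := isEquivalence_baseChangeHom_ringEquiv σ
  exact ⟨isColimitCofanMkObjOfIsColimit (baseChangeHom σ.toRingHom) X ι h⟩

/-- Re-indexing a colimit cofan along an equivalence of index types (as in `Motives/FiniteCoproductVarieties`). [folklore] -/
theorem nonempty_isColimit_cofan_reindex {C : Type*} [Category C] {σ σ' : Type*} {X : σ → C} {S : C}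
    {f : ∀ i, X i ⟶ S} (e : σ' ≃ σ) (hc : IsColimit (Cofan.mk S f)) :
    Nonempty (IsColimit (Cofan.mk S (fun j => f (e j)) : Cofan fun j => X (e j))) :=
  ⟨(Cofan.isColimitEquivOfEquiv e (Cofan.mk S f)) hc⟩

/-! ### (b) `toConjugate` is natural in the `ℂ`-scheme -/

/-- **Naturality of `Y(ℂ) → Y^σ(ℂ)`**: for a morphism `f : X ⟶ Y` of `ℂ`-schemes and a complex point `P` of `X`,
`f^σ (toConjugate P) = toConjugate (f P)`. [cite: CharlesSchnell2014Notes, §11.2.2 (11.2.1)] -/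
theorem map_baseChangeHom_map_toConjugate (σ : ℂ ≃+* ℂ) {X Y : SchemeOver ℂ} (f : X ⟶ Y) (P : ComplexPoints X) :
    AlgPoints.map ((baseChangeHom σ.toRingHom).map f) (toConjugate σ X P) = toConjugate σ Y (AlgPoints.map f P) := by
  apply AlgPoints.ext_of_comp_conjFst
  have h1 : (toConjugate σ Y (AlgPoints.map f P)).toSpecHom ≫ AlgPoints.conjFst σ Y =
      Spec.map (CommRingCat.ofHom σ.toRingHom) ≫ (AlgPoints.map f P).toSpecHom :=
    AlgPoints.toSpecHom_toConjugate_comp_conjFst _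
  have h2 : (AlgPoints.map ((baseChangeHom σ.toRingHom).map f) (toConjugate σ X P)).toSpecHom ≫
        AlgPoints.conjFst σ Y =
      Spec.map (CommRingCat.ofHom σ.toRingHom) ≫ (AlgPoints.map f P).toSpecHom :=
    calc (AlgPoints.map ((baseChangeHom σ.toRingHom).map f) (toConjugate σ X P)).toSpecHom ≫ AlgPoints.conjFst σ Y
        = (toConjugate σ X P).toSpecHom ≫
            (((baseChangeHom σ.toRingHom).map f).left ≫ baseChangeHomFst σ.toRingHom Y) := Category.assoc _ _ _
      _ = (toConjugate σ X P).toSpecHom ≫ (baseChangeHomFst σ.toRingHom X ≫ f.left) :=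
            congrArg (fun t => (toConjugate σ X P).toSpecHom ≫ t) (baseChangeHom_map_left_comp_fst σ.toRingHom f)
      _ = ((toConjugate σ X P).toSpecHom ≫ AlgPoints.conjFst σ X) ≫ f.left := (Category.assoc _ _ _).symm
      _ = (Spec.map (CommRingCat.ofHom σ.toRingHom) ≫ P.toSpecHom) ≫ f.left :=
            congrArg (fun t => t ≫ f.left) (AlgPoints.toSpecHom_toConjugate_comp_conjFst P)
      _ = Spec.map (CommRingCat.ofHom σ.toRingHom) ≫ (AlgPoints.map f P).toSpecHom := Category.assoc _ _ _
  exact h2.trans h1.symm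

end Cofan

end Summit.HodgeConjecture.CorCM.Model.RecordSystemConj

end
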